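import Summits.NavierStokesRegularity.NavierStokesRegularity.Theses.CertifiedBlowup
import Summits.NavierStokesRegularity.NavierStokesRegularity.Theorems.CertifiedBlowupCertifiedBlowupAxisymBlowupStubCompact
import Summits.NavierStokesRegularity.NavierStokesRegularity.Theorems.CertifiedBlowupCertifiedBlowupAxisymBlowupStubH1Step
import Summits.NavierStokesRegularity.NavierStokesRegularity.Theorems.CertifiedBlowupCertifiedBlowupAxisymBlowupStubH1Interp
import Summits.NavierStokesRegularity.NavierStokesRegularity.Theorems.CertifiedBlowupCertifiedBlowupAxisymBlowupStubStabilityOfStep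
import Summits.NavierStokesRegularity.NavierStokesRegularity.Theorems.CertifiedBlowupCertifiedBlowupAxisymBlowupStubMaximal

/-!
# Crux `CertifiedBlowupAxisymBlowup` (stmt-NavierStokesRegularity-0727), line `compact-amplification`:
# the REDUCTION THEOREM — the crux follows from unbounded enstrophy amplification in a compact
# axisymmetric data family (C⁺)

Theorems file (lands `--supports stmt-NavierStokesRegularity-0727`). The line `compact-amplification`
(Cruxes/CertifiedBlowupAxisymBlowup/Lines/compact_amplification.lean; Tao 2013, arXiv:1108.1165,
Thm. 1.20 (vi): "qualitative regularity ⇔ quantitative a priori `H¹` bound", run inside the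
axisymmetric class and inside a compact Schwartz family) transfers the crux X5a_axi

  `∃ ν > 0, ∃ T > 0, ∃ u p, IsMaximalSmoothSolution ν 0 u p T ∧ IsLerayHopfOn T ν 0 (u 0) u ∧
     HasRapidSpatialDecay (u 0) ∧ IsAxisymmetric (u 0)`

to the statement C⁺ (`stub_amplification` of the skeleton, OPEN — it is the crux in the language of
REGULAR solutions): for some `ν > 0` and some table `C k K` of smoothness/decay constants, for every
level `M` there are `T ∈ (0, 1]`, an axisymmetric divergence-free smooth datum `u₀` with
`(1 + |x|)^K ‖Dᵏu₀(x)‖ ≤ C k K`, and a Tao-class solution on `[0, T] × ℝ³` from `u₀` whose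
enstrophy exceeds `M` at some time of `[0, T]`.

This file proves, sorry-free, `certifiedBlowupAxisymBlowup_of_amplification : C⁺ → crux`, from the
five bookkeeping stubs of the line, all landed in this namespace:
`stub_compact` (C^∞ Arzelà–Ascoli on the family, `H¹` convergence to a member),
`stub_stability_of_step stub_h1_step stub_h1_interp` (continuous dependence in `H¹` for Tao's
class: one-step quantitative `H¹` theory + interpolation + the tree's `L²` stability, by
time-stepping), `stub_maximal` (Leray–Hopf maximal development from a datum with no Tao-class
solution on `[0, T]`: Kato maximal time, Lemarié-Rieusset's singular point, Leray graft).
Composition: levels `M = n`; compactness extracts an `H¹`-convergent subsequence of the data with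
limit `a` in the family; were `a` Tao-solvable on `[0, 1]`, stability would cap the enstrophy of the
amplifying solutions from nearby data on their sub-slabs `[0, T_{φ n}] ⊆ [0, 1]`, contradicting
amplification `> φ n ≥ n`; hence `a` has no Tao-class solution on `[0, 1]`, and maximal development
gives the witness. So the crux is CLOSED MODULO C⁺ in Lean: a proof of C⁺ closes
stmt-NavierStokesRegularity-0727 in one line (`certifiedBlowupAxisymBlowup_of_amplification h`).

## References

* T. Tao, *Localisation and compactness properties of the Navier–Stokes global regularity
  problem*, Anal. PDE 6 (2013) = arXiv:1108.1165, Thm. 1.20, Thm. 5.4, §§10–11.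
* J. C. Robinson, J. L. Rodrigo, W. Sadowski, *The Three-Dimensional Navier–Stokes Equations*,
  CUP 2016, Cor. 6.9, Thm. 6.10, Thm. 7.1, Thm. 8.19.
* P. G. Lemarié-Rieusset, *The Navier–Stokes Problem in the 21st Century*, CRC 2016, Thm. 7.2,
  Thm. 15.1.
-/

noncomputable section

open MeasureTheory Set Function Filter Topology
open scoped ENNReal NNReal ContDiff

namespace Summit.NavierStokesRegularity.NavierStokesRegularity.Theorems.CertifiedBlowupAxisymBlowup.CompactAmplification

open Literature.Analysis.FluidPDE
open Summit.NavierStokesRegularity.NavierStokesRegularity.Theses.CertifiedBlowup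

local notation "ℝ³" => EuclideanSpace ℝ (Fin 3)

/-- **The reduction theorem of the line `compact-amplification`: C⁺ ⇒ the crux
`CertifiedBlowupAxisymBlowup` (X5a_axi), by name.** If, for some viscosity `ν > 0` and some table of
constants `C k K`, the enstrophy of Tao-class solutions on sub-slabs of `[0, 1]` from axisymmetric
divergence-free smooth data obeying `(1 + |x|)^K ‖Dᵏu₀(x)‖ ≤ C k K` is unbounded, then some
finite-energy (Leray–Hopf) classical Navier–Stokes solution from a rapidly decaying axisymmetric
datum is maximal with finite lifespan. Proof: amplification levels `M = n`; `stub_compact` extracts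
an `H¹`-convergent subsequence of the data with limit `a` in the family; were `a` Tao-solvable on
`[0, 1]`, `stub_stability_of_step stub_h1_step stub_h1_interp` would bound the enstrophy of the
amplifying solutions from nearby data, contradicting amplification `> φ n ≥ n`; so `a` admits no
Tao-class solution on `[0, 1]` and `stub_maximal` yields the maximal Leray–Hopf development from the
axisymmetric rapidly decaying datum `a`. (The composition `amplification_composition` of the
registered skeleton, with the five landed stubs plugged in.)
[cite: Tao2011, Thm. 1.20 (vi) and Thm. 5.4] -/
theorem certifiedBlowupAxisymBlowup_of_amplification :
    (∃ ν : ℝ, 0 < ν ∧ ∃ C : ℕ → ℕ → ℝ, ∀ M : ℝ, ∃ T : ℝ, 0 < T ∧ T ≤ 1 ∧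
      ∃ (u₀ : EuclideanSpace ℝ (Fin 3) → EuclideanSpace ℝ (Fin 3))
        (u : ℝ → EuclideanSpace ℝ (Fin 3) → EuclideanSpace ℝ (Fin 3))
        (p : ℝ → EuclideanSpace ℝ (Fin 3) → ℝ),
        ContDiff ℝ ∞ u₀ ∧ VectorCalculus.IsDivFree u₀ ∧ IsAxisymmetric u₀ ∧
        (∀ (k K : ℕ) (x : EuclideanSpace ℝ (Fin 3)),
          (1 + ‖x‖) ^ K * ‖iteratedFDeriv ℝ k u₀ x‖ ≤ C k K) ∧
        IsTaoSolutionOn T ν u₀ u p ∧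
        ∃ t ∈ Set.Icc 0 T, ENNReal.ofReal M < ∫⁻ x, ‖fderiv ℝ (u t) x‖ₑ ^ 2) →
    Summit.NavierStokesRegularity.NavierStokesRegularity.Theses.CertifiedBlowup.CertifiedBlowupAxisymBlowup := by
  intro hA
  classical
  -- the three bookkeeping inputs, landed in this namespace
  have hK := stub_compact
  have hS := stub_stability_of_step stub_h1_step stub_h1_interp
  have hM := stub_maximal
  obtain ⟨ν, hν, C, hamp⟩ := hA
  choose T hT0 hT1 u₀ u p hsm hdiv hax hdecay htao t ht hbig using fun n : ℕ => hamp (n : ℝ)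
  obtain ⟨φ, a, hφ, hsm_a, hdiv_a, hax_a, hdec_a, hconv⟩ :=
    hK C u₀ fun n => ⟨hsm n, hdiv n, hax n, hdecay n⟩
  have hdecA : HasRapidSpatialDecay a := fun k K => ⟨C k K, fun x => hdec_a k K x⟩
  -- no Tao-class solution from the limit datum on `[0, 1]`
  have hno : ¬ ∃ (v : ℝ → ℝ³ → ℝ³) (q : ℝ → ℝ³ → ℝ), IsTaoSolutionOn 1 ν a v q := by
    rintro ⟨v, q, hv⟩
    obtain ⟨δ, hδ, B, hstab⟩ := hS ν hν 1 one_pos a v q hv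
    obtain ⟨N, hN⟩ := hconv δ hδ
    set n : ℕ := max N ⌈B⌉₊ with hn_def
    have hnN : N ≤ n := le_max_left _ _
    have hBn : B ≤ (n : ℝ) :=
      (Nat.le_ceil B).trans (by exact_mod_cast le_max_right N ⌈B⌉₊)
    have hnφ : (n : ℝ) ≤ ((φ n : ℕ) : ℝ) := by exact_mod_cast hφ.id_le n
    have hdecφ : HasRapidSpatialDecay (u₀ (φ n)) :=
      fun k K => ⟨C k K, fun x => hdecay (φ n) k K x⟩
    have hbd := hstab (u₀ (φ n)) (hsm _) (hdiv _) hdecφ (hN n hnN) (T (φ n)) (u (φ n)) (p (φ n))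
      (hT0 _) (hT1 _) (htao _) (t (φ n)) (ht _)
    have hlt : ENNReal.ofReal (((φ n : ℕ) : ℝ)) < ENNReal.ofReal B := lt_of_lt_of_le (hbig _) hbd
    have hlt' : ((φ n : ℕ) : ℝ) < B :=
      (ENNReal.ofReal_lt_ofReal_iff_of_nonneg (Nat.cast_nonneg _)).1 hlt
    linarith
  obtain ⟨Ts, hTs0, -, U, P, hU0, hmax, hLH⟩ := hM ν hν 1 one_pos a hsm_a hdiv_a hdecA hno
  refine ⟨ν, hν, Ts, hTs0, U, P, hmax, ?_, ?_, ?_⟩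
  · rw [hU0]; exact hLH
  · rw [hU0]; exact hdecA
  · rw [hU0]; exact hax_a

end Summit.NavierStokesRegularity.NavierStokesRegularity.Theorems.CertifiedBlowupAxisymBlowup.CompactAmplification

end
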